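import Summits.AnomalousDissipation.AnomalousDissipation.Theses.EnsembleRigidity
import Summits.AnomalousDissipation.AnomalousDissipation.Theorems.EnsembleRigidityDefs
import HarnessLib

/-!
# Birth skeleton (BC3) — crux `EnsembleRigidity.GPStatisticalRigidity` (stmt-AnomalousDissipation-15508)

Route `route-AnomalousDissipation-EnsembleRigidity`, crux #2 (STATISTICAL LAMB RIGIDITY OF `f_GP`): for every
energy level `E` there are `c, δ₀ > 0` such that every Borel probability measure `μ` on `H = L²_σ(T³)` with
integrable energy, mean energy `≤ E`, finite mean enstrophy `G`, non-negative shell work and cylindrical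
forced-Euler defect `|∫ ⟨f_GP − B(v,v), Φ'(v)⟩ dμ| ≤ R (∫ ‖∇Φ'(v)‖² dμ)^{1/2}` (all cylindrical `Φ`),
`0 ≤ R ≤ δ₀`, pays `c ≤ R √G`.

This file is the route-level BIRTH CERTIFICATE skeleton of the crux (LENSES-v3 §2 BC3; registrar seat
`planner-skel-stmt-AnomalousDissipation-15508-0`, 2026-08-17). It records the architecture of the crux's live
line `Lines/Sketch.lean` (lead `prover-line-stmt-AnomalousDissipation-15508-0`; certificate / weak-duality
architecture of idea `odd-lyapunov-certificate-family`, after its cycle-1 reshape) as three NAMED PIECES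
(stubs S, W2, C2), a sorry-free composition `gpRigidityBlock_of_pieces : S-sig → W2-sig → C2-sig → (the crux's
conclusion block at every level)`, and the skeleton theorem `GPStatisticalRigidity_of : GPStatisticalRigidity`
(the crux BY NAME, from the three stubs through the composition), so that the pieces and their composition are
kernel-checked with `sorry` occurring ONLY inside the stubs (gate shape: the gate's `skeleton check` requires the
crux-concluding theorem to take no hypotheses other than registered obligations by name — hence the implication
content lives in `gpRigidityBlock_of_pieces` and `_of` discharges its hypotheses with the stubs):

* `stub_gpSmallEnergyRegime` (S) — THE VACUOUS REGIME. Below the second-moment horizon, `E < 3/(4π)`, the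
  crux's conclusion block holds (with `c = 1`, `δ₀ = (3/2 − 2πE)/(2π√6)`): testing the defect clause against
  the fixed field `w = f_GP` (cut-off removal) gives `|3/2 + ∫∫⟨∇f_GP v, v⟩ dμ| ≤ R ‖∇f_GP‖₂ = R π√6`, and
  `⟨∇f_GP(x)v, v⟩ ≥ −2π|v|²` gives `(3/2 − 2πE)/(π√6) ≤ R`, i.e. no admissible `μ` has a small defect
  (Doering–Foias). LANDED in kind: `Theorems.EnsembleRigidity.GPStatisticalRigidity.gpRigid_smallEnergy`
  (file `Theorems/EnsembleRigidityGPStatisticalRigidityPartial.lean`, p130614) has exactly this statement, so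
  this stub is dischargeable by `exact`; it is kept as a NAMED PIECE of the decomposition.
* `stub_weakDuality2` (W2) — WEAK DUALITY WITH QUADRATIC ROUGHNESS ALLOWANCE. If for every roughness scale
  `Λ > 0` there is a cylindrical certificate `Ψ_Λ` with cost `‖∇Ψ_Λ'(v)‖² ≤ C²(1 + ‖∇v‖²)` and the pointwise
  forced-Euler Lyapunov inequality `a − b|v|² − Λ⁻¹(1 + ‖∇v‖²) ≤ ⟨f − B(v,v), Ψ_Λ'(v)⟩` on finite-enstrophy
  fields, `b ≥ 0`, `a − bE ≥ γ > 0` (`γ, C` uniform in `Λ`), then the crux's conclusion block holds at level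
  `E` with `c = δ₀ = γ/(4C)` (integrate against `μ`, choose `Λ = 2(1+G)/γ` after seeing `μ`). LANDED:
  `Theorems.EnsembleRigidity.GPStatisticalRigidity.stub_weakDuality2` (p130387), same statement.
* `stub_gpCertificateFamily2` (C2) — THE OPEN CONTENT (identical to the open stub of `Lines/Sketch.lean`).
  Above the horizon, `E ≥ 3/(4π)`, `f_GP` admits for every `Λ > 0` a cylindrical Lyapunov certificate of
  forced Euler with margin `γ(E) > 0` and relative `H¹`-cost `C(E)` uniform in `Λ`. It is the Farkas-dual
  shape of "no probability measure on `H` of mean energy `≤ E` and mean enstrophy `≤ G₀` is cylindrically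
  stationary for forced Euler with force `f_GP`", with roughness charged QUADRATICALLY so that the positivity
  region is `L²`-compact (the first, linear-allowance shape was refuted by the lead above level
  `√12 ‖f_GP‖_{Ḣ⁻¹} ≈ 0.675`; see `Lines/Sketch.md`).
* `gpRigidityBlock_of_pieces : S-sig → W2-sig → C2-sig → ∀ f = f_GP, ∀ E, (conclusion block of the crux)` —
  SORRY-FREE (axioms propext / Classical.choice / Quot.sound): split on the horizon `E < 3/(4π)` (S) /
  `E ≥ 3/(4π)` (W2 applied to the family C2), discard the shell-work hypothesis (idle by the time-reversal normal
  form, `stub_desaturation`, landed p130125).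
* `GPStatisticalRigidity_of : GPStatisticalRigidity` — the crux BY NAME: pin the force (`gpForce_eq` is `rfl`)
  and apply `gpRigidityBlock_of_pieces` to the three stubs. Its only non-whitelisted axiom is the `sorryAx` of the
  stubs; it closes the crux the day C2 lands (S and W2 being dischargeable by landed theorems today).

## Disproof used (`Cruxes/GPStatisticalRigidity/Disproof.lean`, cdisprove cycle 1, read 2026-08-17)

* `Negative/LoadBearing.lean`: `gpStatisticalRigidity_false_without_prob`, `…_false_without_defect` — both
  the probability and the defect clause are kept verbatim in S and W2 (they are the hypotheses W2 integrates);
  the `R = 0` kill switch `not_gpStatisticalRigidity_of_exactEulerStatistics` is a NECESSARY condition of C2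
  (an exact finite-enstrophy Euler statistics of energy `≤ E` integrates the certificate inequality to
  `γ ≤ a − bE ≤ Λ⁻¹(1+G)` for every `Λ`, absurd), consistent.
* `Negative/DiracShadow.lean`: the Dirac instance of the crux is single-field Lamb rigidity; the work sign is
  void on Diracs — consistent with the composition, which never uses the shell clause.
* §6 `GPStatisticalRigidityUniform` (level-uniform constants) is heuristically false — NOT claimed here:
  `(γ, C)(E)`, hence `(c, δ₀)(E)`, are level-wise in C2/W2.
* No `-- Targets` entry of the disproof file hits S, W2 or C2; no landed Negative lemma refutes an instance of
  a stub (S and W2 are theorems in the tree).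

## BC3 probes (registrar, 2026-08-17; files `bc/birth_probe_*.lean` of the registrar's folder)

For each stub `X ∈ {S, W2, C2}` (its statement pasted as a closed Prop; imports: the route file and
`Theorems.EnsembleRigidityDefs` only): `example : X → GPStatisticalRigidity` and `example : X → AnomalousDissipation`
by `first | exact? | simpa | aesop` under `set_option maxHeartbeats 400000`, and each alternative alone — ALL 24
FAIL (6/6 required probes): S→crux: combined = deterministic timeout at 400 000 heartbeats, `exact?` "could not
close the goal", `simpa` "assumption failed", `aesop` "failed to prove the goal after exhaustive search"; S→summit:
all four fail the same way (combined: aesop exhaustive-search failure); W2→crux and W2→summit: `exact?` "could not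
close the goal", combined / `simpa` / `aesop` time out at 400 000 heartbeats normalising the hypothesis; C2→crux and
C2→summit: combined and `aesop` "failed after exhaustive search", `exact?` "could not close", `simpa` "assumption
failed". No stub is cheaply the crux or the summit: S is the crux's block on `E < 3/(4π)` only, W2 is a conditional
transfer that needs a certificate family, C2 produces certificates, not rigidity constants.

## References

* C. Foias, O. Manley, R. Rosa, R. Temam, *Navier–Stokes Equations and Turbulence* (CUP 2001), Ch. IV §1.2
  Def. 1.3, (1.29)–(1.31). [FoiasManleyRosaTemam2001]
* C. Doering, C. Foias, J. Fluid Mech. 467 (2002) §3 (second-moment bounds). [DoeringFoias2002]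
* R. Rosa, R. Temam, arXiv:2010.06730 (auxiliary functionals / minimax for statistical solutions).
* I. Tobasco, D. Goluskin, C. Doering, arXiv:1705.07096 (sharpness of auxiliary-functional bounds).
* S. Friedlander, N. Glatt-Holtz, V. Vicol, arXiv:1404.1098 §2.3 (statistical K41, open problem (ii)).
-/

-- `Summit.<Summit>.<Problem>` is the tree's mandated summit-side namespace (CONVENTIONS §2); single-conjunct summit, duplicate deliberate.
set_option linter.dupNamespace false

noncomputable section

namespace Summit.AnomalousDissipation.AnomalousDissipation.Cruxes.GPStatisticalRigidity.Birth

open MeasureTheory Filter Topology UnitAddTorus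
open scoped InnerProductSpace RealInnerProductSpace ENNReal NNReal
open Literature.Analysis.FunctionSpaces Literature.Analysis.FluidPDE
open Summit.AnomalousDissipation.AnomalousDissipation.Theorems.EnsembleRigidity

/-- Local notation: real vector fields on `T³`. -/
local notation "Vec3" => (UnitAddTorus (Fin 3)) → (EuclideanSpace ℝ (Fin 3))
/-- Local notation: `L²(T³; ℝ³)`. -/
local notation "L2" => (Lp (EuclideanSpace ℝ (Fin 3)) 2 (volume : Measure (UnitAddTorus (Fin 3))))
/-- Local notation: the energy space `H`. -/
local notation "H3" => (Torus.energySpace (Fin 3))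

/-! ## Stubs -/

/-- **S `stub_gpSmallEnergyRegime`** — THE VACUOUS REGIME (below the second-moment horizon). For
`E < 3/(4π)` the conclusion block of `GPStatisticalRigidity` holds at level `E`: an admissible `μ` with
defect `R ≤ δ₀ := (3/2 − 2πE)/(2π√6)` would satisfy the fixed-test balance at `w = f_GP` (cut-off removal)
and hence `(3/2 − 2πE)/(π√6) ≤ R` (second-moment test: `‖f_GP‖₂² = 3/2`, `‖∇f_GP‖₂ = π√6`,
`⟨∇f_GP(x)v,v⟩ ≥ −2π|v|²`), i.e. `2δ₀ ≤ R ≤ δ₀`, absurd. Size M. LANDED in kind (same statement):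
`Theorems.EnsembleRigidity.GPStatisticalRigidity.gpRigid_smallEnergy` (p130614). [DoeringFoias2002] -/
theorem stub_gpSmallEnergyRegime (f : Vec3) (hf : f = gpForce) (E : ℝ) (hE : E < 3 / (4 * Real.pi)) :
    ∃ c δ₀ : ℝ, 0 < c ∧ 0 < δ₀ ∧ ∀ μ : Measure H3, IsProbabilityMeasure μ →
      Integrable (fun v : H3 => ‖v‖ ^ 2) μ → Torus.ensembleEnergy μ ≤ E → Torus.ensembleEnstrophy μ < ⊤ →
      ∀ R : ℝ, 0 ≤ R → R ≤ δ₀ →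
        (∀ Φ : Torus.CylindricalTest (Fin 3),
          Integrable (fun v : H3 => Torus.nsGeneratorPairing 0 f v (Φ.grad v)) μ ∧
            |∫ v, Torus.nsGeneratorPairing 0 f v (Φ.grad v) ∂μ| ≤
              R * Real.sqrt (∫ v, Torus.gradNormSq (Φ.grad v) ∂μ)) →
        c ≤ R * Real.sqrt (Torus.ensembleEnstrophy μ).toReal := by
  sorry

/-- **W2 `stub_weakDuality2`** — WEAK DUALITY WITH THE QUADRATIC ROUGHNESS ALLOWANCE (Farkas-dual shape).
If for every roughness scale `Λ > 0` there is a cylindrical certificate `Ψ_Λ` with cost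
`‖∇Ψ_Λ'(v)‖² ≤ C²(1 + ‖∇v‖²)` and the pointwise forced-Euler Lyapunov inequality
`a − b|v|² − Λ⁻¹(1 + ‖∇v‖²) ≤ ⟨f − B(v,v), Ψ_Λ'(v)⟩` on finite-enstrophy fields, `b ≥ 0`, `a − bE ≥ γ > 0`
(`γ, C` uniform in `Λ`), then every probability measure on `H` with integrable energy `≤ E`, finite mean
enstrophy `G` and cylindrical forced-Euler defect `≤ R ≤ δ₀` pays `c ≤ R √G`, with `c = δ₀ = γ/(4C)`
(integrate, `Λ := 2(1+G)/γ` chosen after seeing `μ`). Size M. LANDED (same statement):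
`Theorems.EnsembleRigidity.GPStatisticalRigidity.stub_weakDuality2` (p130387).
[FoiasManleyRosaTemam2001, arXiv:2010.06730] -/
theorem stub_weakDuality2 (f : Vec3) (E γ C : ℝ) (hγ : 0 < γ) (hC : 0 < C)
    (hfam : ∀ Λ : ℝ, 0 < Λ → ∃ (Ψ : Torus.CylindricalTest (Fin 3)) (a b : ℝ), 0 ≤ b ∧ γ ≤ a - b * E ∧
      (∀ v : H3, Torus.gradNormSq (Ψ.grad v) ≤
        C ^ 2 * (1 + (Torus.eGradNormSq ((v : L2) : Vec3)).toReal)) ∧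
      (∀ v : H3, Torus.eGradNormSq ((v : L2) : Vec3) ≠ ⊤ →
        a - b * ‖v‖ ^ 2 - Λ⁻¹ * (1 + (Torus.eGradNormSq ((v : L2) : Vec3)).toReal) ≤
          Torus.nsGeneratorPairing 0 f v (Ψ.grad v))) :
    ∃ c δ₀ : ℝ, 0 < c ∧ 0 < δ₀ ∧ ∀ μ : Measure H3, IsProbabilityMeasure μ →
      Integrable (fun v : H3 => ‖v‖ ^ 2) μ → Torus.ensembleEnergy μ ≤ E → Torus.ensembleEnstrophy μ < ⊤ →
      ∀ R : ℝ, 0 ≤ R → R ≤ δ₀ →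
        (∀ Φ : Torus.CylindricalTest (Fin 3),
          Integrable (fun v : H3 => Torus.nsGeneratorPairing 0 f v (Φ.grad v)) μ ∧
            |∫ v, Torus.nsGeneratorPairing 0 f v (Φ.grad v) ∂μ| ≤
              R * Real.sqrt (∫ v, Torus.gradNormSq (Φ.grad v) ∂μ)) →
        c ≤ R * Real.sqrt (Torus.ensembleEnstrophy μ).toReal := by
  sorry

/-- **C2 `stub_gpCertificateFamily2`** — THE OPEN CONTENT (identical to the open stub of line `Sketch`).
Above the second-moment horizon, `E ≥ 3/(4π)`, the Galloway–Proctor force admits, for every roughness scale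
`Λ > 0`, a cylindrical Lyapunov certificate `Ψ_Λ` of forced Euler with margin `γ(E) > 0` and relative
`H¹`-cost `C(E)` uniform in `Λ`: `a − b|v|² − Λ⁻¹(1 + ‖∇v‖²) ≤ ⟨f_GP − B(v,v), Ψ_Λ'(v)⟩` at every
finite-enstrophy `v ∈ H`, `b ≥ 0`, `a − bE ≥ γ`, `‖∇Ψ_Λ'(v)‖² ≤ C²(1 + ‖∇v‖²)`. Farkas-dual shape of "no
probability measure on `H` of mean energy `≤ E` and mean enstrophy `≤ G₀` is cylindrically stationary for
forced Euler with `f_GP`", roughness charged quadratically (positivity region `L²`-compact by Rellich).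
NECESSARY CONDITIONS (Disproof.lean kill class): no exact finite-enstrophy Euler-stationary statistics of
`f_GP` of mean energy `≤ E`; no invariant probability measure of any projected (Petrov–Galerkin) forced-Euler
field in the core `{b|v_y|² + Λ⁻¹(1+‖∇v_y‖²) < a}`. Size: open problem. No such family is known in print.
[FoiasManleyRosaTemam2001, arXiv:2010.06730, arXiv:1705.07096, arXiv:1404.1098] -/
theorem stub_gpCertificateFamily2 (f : Vec3) (hf : f = gpForce) (E : ℝ) (hE : 3 / (4 * Real.pi) ≤ E) :
    ∃ γ C : ℝ, 0 < γ ∧ 0 < C ∧ ∀ Λ : ℝ, 0 < Λ →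
      ∃ (Ψ : Torus.CylindricalTest (Fin 3)) (a b : ℝ), 0 ≤ b ∧ γ ≤ a - b * E ∧
        (∀ v : H3, Torus.gradNormSq (Ψ.grad v) ≤
          C ^ 2 * (1 + (Torus.eGradNormSq ((v : L2) : Vec3)).toReal)) ∧
        (∀ v : H3, Torus.eGradNormSq ((v : L2) : Vec3) ≠ ⊤ →
          a - b * ‖v‖ ^ 2 - Λ⁻¹ * (1 + (Torus.eGradNormSq ((v : L2) : Vec3)).toReal) ≤
            Torus.nsGeneratorPairing 0 f v (Ψ.grad v)) := by
  sorry

/-! ## Composition -/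

/-- **The crux's conclusion block at every level, from the three pieces** (SORRY-FREE composition; the
implication content of the skeleton). Hypotheses: the statements of S, W2 and C2, verbatim. Conclusion: for the
pinned force and every level `E`, the constants `c, δ₀` and the rigidity inequality of `GPStatisticalRigidity`
(shell-work clause accepted and discarded). Proof: split on the horizon `E < 3/(4π)` (S) / `E ≥ 3/(4π)` (W2
applied to the family C2). -/
theorem gpRigidityBlock_of_pieces
    (hS : ∀ (f : Vec3), f = gpForce → ∀ E : ℝ, E < 3 / (4 * Real.pi) →
      ∃ c δ₀ : ℝ, 0 < c ∧ 0 < δ₀ ∧ ∀ μ : Measure H3, IsProbabilityMeasure μ →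
        Integrable (fun v : H3 => ‖v‖ ^ 2) μ → Torus.ensembleEnergy μ ≤ E → Torus.ensembleEnstrophy μ < ⊤ →
        ∀ R : ℝ, 0 ≤ R → R ≤ δ₀ →
          (∀ Φ : Torus.CylindricalTest (Fin 3),
            Integrable (fun v : H3 => Torus.nsGeneratorPairing 0 f v (Φ.grad v)) μ ∧
              |∫ v, Torus.nsGeneratorPairing 0 f v (Φ.grad v) ∂μ| ≤
                R * Real.sqrt (∫ v, Torus.gradNormSq (Φ.grad v) ∂μ)) →
          c ≤ R * Real.sqrt (Torus.ensembleEnstrophy μ).toReal)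
    (hW : ∀ (f : Vec3) (E γ C : ℝ), 0 < γ → 0 < C →
      (∀ Λ : ℝ, 0 < Λ → ∃ (Ψ : Torus.CylindricalTest (Fin 3)) (a b : ℝ), 0 ≤ b ∧ γ ≤ a - b * E ∧
        (∀ v : H3, Torus.gradNormSq (Ψ.grad v) ≤
          C ^ 2 * (1 + (Torus.eGradNormSq ((v : L2) : Vec3)).toReal)) ∧
        (∀ v : H3, Torus.eGradNormSq ((v : L2) : Vec3) ≠ ⊤ →
          a - b * ‖v‖ ^ 2 - Λ⁻¹ * (1 + (Torus.eGradNormSq ((v : L2) : Vec3)).toReal) ≤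
            Torus.nsGeneratorPairing 0 f v (Ψ.grad v))) →
      ∃ c δ₀ : ℝ, 0 < c ∧ 0 < δ₀ ∧ ∀ μ : Measure H3, IsProbabilityMeasure μ →
        Integrable (fun v : H3 => ‖v‖ ^ 2) μ → Torus.ensembleEnergy μ ≤ E → Torus.ensembleEnstrophy μ < ⊤ →
        ∀ R : ℝ, 0 ≤ R → R ≤ δ₀ →
          (∀ Φ : Torus.CylindricalTest (Fin 3),
            Integrable (fun v : H3 => Torus.nsGeneratorPairing 0 f v (Φ.grad v)) μ ∧
              |∫ v, Torus.nsGeneratorPairing 0 f v (Φ.grad v) ∂μ| ≤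
                R * Real.sqrt (∫ v, Torus.gradNormSq (Φ.grad v) ∂μ)) →
          c ≤ R * Real.sqrt (Torus.ensembleEnstrophy μ).toReal)
    (hC : ∀ (f : Vec3), f = gpForce → ∀ E : ℝ, 3 / (4 * Real.pi) ≤ E →
      ∃ γ C : ℝ, 0 < γ ∧ 0 < C ∧ ∀ Λ : ℝ, 0 < Λ →
        ∃ (Ψ : Torus.CylindricalTest (Fin 3)) (a b : ℝ), 0 ≤ b ∧ γ ≤ a - b * E ∧
          (∀ v : H3, Torus.gradNormSq (Ψ.grad v) ≤
            C ^ 2 * (1 + (Torus.eGradNormSq ((v : L2) : Vec3)).toReal)) ∧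
          (∀ v : H3, Torus.eGradNormSq ((v : L2) : Vec3) ≠ ⊤ →
            a - b * ‖v‖ ^ 2 - Λ⁻¹ * (1 + (Torus.eGradNormSq ((v : L2) : Vec3)).toReal) ≤
              Torus.nsGeneratorPairing 0 f v (Ψ.grad v)))
    (f : Vec3) (hf : f = gpForce) (E : ℝ) :
    ∃ c δ₀ : ℝ, 0 < c ∧ 0 < δ₀ ∧ ∀ μ : Measure H3, IsProbabilityMeasure μ →
      Integrable (fun v : H3 => ‖v‖ ^ 2) μ → Torus.ensembleEnergy μ ≤ E → Torus.ensembleEnstrophy μ < ⊤ →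
      (∀ e₁ e₂ : ℝ≥0∞, e₁ < e₂ →
        0 ≤ ∫ v in {v : H3 | e₁ ≤ ‖v‖ₑ ^ 2 ∧ ‖v‖ₑ ^ 2 < e₂}, Torus.pairing (v : L2) f ∂μ) →
      ∀ R : ℝ, 0 ≤ R → R ≤ δ₀ →
        (∀ Φ : Torus.CylindricalTest (Fin 3),
          Integrable (fun v : H3 => Torus.nsGeneratorPairing 0 f v (Φ.grad v)) μ ∧
            |∫ v, Torus.nsGeneratorPairing 0 f v (Φ.grad v) ∂μ| ≤
              R * Real.sqrt (∫ v, Torus.gradNormSq (Φ.grad v) ∂μ)) →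
        c ≤ R * Real.sqrt (Torus.ensembleEnstrophy μ).toReal := by
  by_cases hE : E < 3 / (4 * Real.pi)
  · -- the vacuous regime below the second-moment horizon (S)
    obtain ⟨c, δ₀, hc, hδ₀, hrig⟩ := hS f hf E hE
    exact ⟨c, δ₀, hc, hδ₀, fun μ hμ hint hEμ hG _hshell R hR0 hRδ hdef =>
      hrig μ hμ hint hEμ hG R hR0 hRδ hdef⟩
  · -- above the horizon: weak duality (W2) applied to the certificate family (C2)
    have hE' : 3 / (4 * Real.pi) ≤ E := le_of_not_gt hE
    obtain ⟨γ, C, hγ, hC0, hfam⟩ := hC f hf E hE'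
    obtain ⟨c, δ₀, hc, hδ₀, hrig⟩ := hW f E γ C hγ hC0 hfam
    exact ⟨c, δ₀, hc, hδ₀, fun μ hμ hint hEμ hG _hshell R hR0 hRδ hdef =>
      hrig μ hμ hint hEμ hG R hR0 hRδ hdef⟩

/-- **Statistical Lamb rigidity of `f_GP`** — the route declaration `EnsembleRigidity.GPStatisticalRigidity`
(item stmt-AnomalousDissipation-15508) BY NAME, from the three registered stubs through the sorry-free
composition `gpRigidityBlock_of_pieces`: pin the force (the crux's inline sum of three Stokes modes is `gpForce`
by `rfl`, `gpForce_eq`) and apply the block at level `E`. The only `sorry` in its closure is the stubs'. -/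
theorem GPStatisticalRigidity_of :
    Summit.AnomalousDissipation.AnomalousDissipation.Theses.EnsembleRigidity.GPStatisticalRigidity := by
  intro f hf E
  exact gpRigidityBlock_of_pieces stub_gpSmallEnergyRegime stub_weakDuality2 stub_gpCertificateFamily2 f
    (hf.trans gpForce_eq.symm) E

end Summit.AnomalousDissipation.AnomalousDissipation.Cruxes.GPStatisticalRigidity.Birth

end
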